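import Mathlib
import Literature.NumberTheory.LFunctions.Zhang2022.Section18EpsilonIdentity
import HarnessLib

/-!
# Zhang (2022) Lemma 15.1 / §18 constants PARAMETRISED over the value of `e″₁ⱼ` (RT-05, the e″-fork)

Topic `Literature/NumberTheory/LFunctions/Zhang2022` (Landau–Siegel audit tree; verdict-neutral).
Y. Zhang, *Discrete mean estimates and the Landau–Siegel zero*, arXiv:2211.02515v1 (2022)
[Zhang2022LandauSiegel] — an unrefereed manuscript under adjudication; nothing here asserts or denies
its Theorems 1–2. Lane ZHANG-L, RULINGS R-22/R-28 = RE-TYPE RT-05 (zl-lead; zl-ref-chief conditions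
C1–C5; RETYPE-LEDGER row RT-05), the ONE shared definition file that the §15/§16/§17 E-twins
(zl-w15-typer, zl-w16-typer) and the skeleton's E-chain (zl-skel) import.

WHY. Lemma 15.1 (§15 p. 86) states `𝔢ⱼ = (e₁ⱼ + ι₂e₂ⱼ)(ῑ₃e₃ⱼ + ῑ₄e₂ⱼ)`, `e₁ⱼ = e′₁ⱼ − e″₁ⱼ`, with
`e″₁ⱼ` AS STATED = `e1ppj` (Section18Defs), while the manuscript's own Appendix-B computation (last
display of the proof of (B.3)) yields the DIFFERENT number `e1ppD j = −jπi·b*` (`AppendixB.e1ppD`,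
`AppendixB.e1ppD_eq`; cell rows G-L4t10-1, G-num2-1, D-G-num2-1: "dischargers should target the
e1ppD reading"; kernel: `Numerics.not_StepB_u015c`, `Numerics.appB3_chain_inconsistent`,
`Section18EpsilonIdentity.e1pp_delta_one_norm_bounds`). RT-05 therefore carries the whole 𝔢-chain
PARAMETRISED over `e1pp : ℕ → ℂ` (condition C1: parametrise ONCE, at the level of `𝔢`) and
instantiates it at the DERIVED constant `e″ = −jπi·b*` (App. B's own computation), NOT the value
stated in Lemma 15.1/(B.3); the printed declarations stay byte-untouched and are the `e1ppj`-instances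
of the family BY `rfl` (so the as-printed record and all landed negatives remain valid):
`frake j = frakeE e1ppj j`, `frakeD j = frakeE e1ppD j`, `frakc3 = frakc3E e1ppj`,
`frakc3D = frakc3E e1ppD`. Definitions + `rfl` bridges only (no claims); root namespace
`Literature.NumberTheory.LFunctions.Zhang2022`, next to `frake` (Section18Defs) / `frakeD`
(Section18EpsilonIdentity). No instances, no notation.

## References
* Y. Zhang, arXiv:2211.02515v1 (2022), §15 Lemma 15.1 p. 86; §18 (18.1) p. 99; Appendix B (B.3)
  p. 108. [cite: Zhang2022LandauSiegel, §15 Lemma 15.1 p. 86]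
-/

noncomputable section

open Complex Real ComplexConjugate

namespace Literature.NumberTheory.LFunctions.Zhang2022

/-- `e₁ⱼ = e′₁ⱼ − e″₁ⱼ` (Lemma 15.1) with the value of `e″₁ⱼ` a PARAMETER `e1pp : ℕ → ℂ` (RT-05):
`e1jE e1pp j = e1pj j − e1pp j`; `e1j = e1jE e1ppj`, `e1jD = e1jE e1ppD`.
[cite: Zhang2022LandauSiegel, §15 Lemma 15.1 p. 86] -/
def e1jE (e1pp : ℕ → ℂ) (j : ℕ) : ℂ := e1pj j - e1pp j

/-- **`𝔢ⱼ` parametrised over `e″` (RT-05, C1)**: `frakeE e1pp j = (e1jE e1pp j + ι₂e₂ⱼ)(ῑ₃e₃ⱼ + ῑ₄e₂ⱼ)`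
— Lemma 15.1's `𝔢ⱼ = (e₁ⱼ + ι₂e₂ⱼ)(ῑ₃e₃ⱼ + ῑ₄e₂ⱼ)` with `e″₁ⱼ := e1pp j`. Instances: `frake` (stated
`e″`, `frake_eq_frakeE_e1ppj`), `frakeD` (DERIVED `e″ = −jπi·b*`, `frakeD_eq_frakeE_e1ppD`).
[cite: Zhang2022LandauSiegel, §15 Lemma 15.1 p. 86] -/
def frakeE (e1pp : ℕ → ℂ) (j : ℕ) : ℂ :=
  (e1jE e1pp j + iota2 * e2j j) * (conj iota3 * e3j j + conj iota4 * e2j j)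

/-- `𝔢″ⱼ = e″₁ⱼ(ῑ₃e₃ⱼ + ῑ₄e₂ⱼ)` (§18 before (18.2)) with `e″₁ⱼ := e1pp j`; instances `frakepp`
(`e1ppj`), `frakeppD` (`e1ppD`). [cite: Zhang2022LandauSiegel, §18 before (18.2)] -/
def frakeppE (e1pp : ℕ → ℂ) (j : ℕ) : ℂ := e1pp j * (conj iota3 * e3j j + conj iota4 * e2j j)

/-- **`𝔠₃` parametrised over `e″` (RT-05)**: (18.1), explicit part,
`𝔠₃ = −i(3𝔢₁ + 3𝔢₂ + 𝔢₃ + 𝔢₀) + e₁* + 2e₂*` with `𝔢ⱼ := frakeE e1pp j`. Instances: `frakc3`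
(`e1ppj`), `frakc3D` (`e1ppD`). [cite: Zhang2022LandauSiegel, §18 (18.1) p. 99] -/
def frakc3E (e1pp : ℕ → ℂ) : ℂ :=
  -I * (3 * frakeE e1pp 1 + 3 * frakeE e1pp 2 + frakeE e1pp 3 + frake0) + e1star + 2 * e2star

/-! ## `rfl` bridges: the printed and the derived constants are instances of the family -/

/-- `e1j j = e1jE e1ppj j` (`rfl`). [cite: Zhang2022LandauSiegel, §15 Lemma 15.1 p. 86] -/
theorem e1j_eq_e1jE_e1ppj (j : ℕ) : e1j j = e1jE e1ppj j := rfl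

/-- `e1jD j = e1jE e1ppD j` (`rfl`). [cite: Zhang2022LandauSiegel, Appendix B (B.3) p. 108] -/
theorem e1jD_eq_e1jE_e1ppD (j : ℕ) : e1jD j = e1jE e1ppD j := rfl

/-- **`frake j = frakeE e1ppj j`** (`rfl`): the STATED `𝔢ⱼ` is the `e1ppj`-instance.
[cite: Zhang2022LandauSiegel, §15 Lemma 15.1 p. 86] -/
theorem frake_eq_frakeE_e1ppj (j : ℕ) : frake j = frakeE e1ppj j := rfl

/-- **`frakeD j = frakeE e1ppD j`** (`rfl`): the DERIVED `𝔢ⱼ` (Section18EpsilonIdentity) is the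
`e1ppD`-instance. [cite: Zhang2022LandauSiegel, Appendix B (B.3) p. 108] -/
theorem frakeD_eq_frakeE_e1ppD (j : ℕ) : frakeD j = frakeE e1ppD j := rfl

/-- `frakepp j = frakeppE e1ppj j` (`rfl`). [cite: Zhang2022LandauSiegel, §18 before (18.2)] -/
theorem frakepp_eq_frakeppE_e1ppj (j : ℕ) : frakepp j = frakeppE e1ppj j := rfl

/-- `frakeppD j = frakeppE e1ppD j` (`rfl`). [cite: Zhang2022LandauSiegel, §18 before (18.2)] -/
theorem frakeppD_eq_frakeppE_e1ppD (j : ℕ) : frakeppD j = frakeppE e1ppD j := rfl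

/-- **`frakc3 = frakc3E e1ppj`** (`rfl`). [cite: Zhang2022LandauSiegel, §18 (18.1) p. 99] -/
theorem frakc3_eq_frakc3E_e1ppj : frakc3 = frakc3E e1ppj := rfl

/-- **`frakc3D = frakc3E e1ppD`** (`rfl`). [cite: Zhang2022LandauSiegel, §18 (18.1) p. 99] -/
theorem frakc3D_eq_frakc3E_e1ppD : frakc3D = frakc3E e1ppD := rfl

/-- As functions: `frake = frakeE e1ppj` (`rfl`). [cite: Zhang2022LandauSiegel, §15 Lemma 15.1 p. 86] -/
theorem frakeE_e1ppj : frakeE e1ppj = frake := rfl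

/-- As functions: `frakeD = frakeE e1ppD` (`rfl`). [cite: Zhang2022LandauSiegel, Appendix B (B.3) p. 108] -/
theorem frakeE_e1ppD : frakeE e1ppD = frakeD := rfl

end Literature.NumberTheory.LFunctions.Zhang2022
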